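import Mathlib
import HarnessLib
import Summits.CriticalPhenomena.SAWScalingLimit.Theses.SAWDevelopingMap
import Summits.CriticalPhenomena.SAWScalingLimit.Theorems.ObservableToSLE.Negative.Identification
import Literature.Probability.RandomPlanarGeometry.HexSAW
import Literature.Probability.RandomPlanarGeometry.HexParafermion
import Literature.Probability.RandomPlanarGeometry.RestrictionHulls
import Literature.Probability.RandomPlanarGeometry.ConformalRectangle
import Literature.Probability.RandomPlanarGeometry.HullSubdomainPullback

/-!
# Line `coalescent-arc-restriction` — skeleton for crux `ObservableToSLE` (stmt-CriticalPhenomena-10472)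

Crux (route `SAWDevelopingMap`, shared by `SAWResidueField`, `SAWDefectDecoherence`, `SAWWindingAlias`,
`SAWPhaseRetrieval`): `ObservableToSLE := HexObservableLimit → HexTight → (DCS Conjecture 1 written out)`.

Idea (card `Ideas/coalescent-arc-restriction.md`, triage r1-1/2/3 pass): spend the hypothesis
`HexObservableLimit` (DCS Conjecture 2, ψ-averaged, normalised at ONE flat boundary mid-edge) only
through TWO normalisation points `b` and `s` of the SAME observable `F_δ` (the constant `c`, the test
function `ψ`, the bulk exponent and the deterministic boundary winding all cancel), which gives the
boundary two-point law `Z_δ(a→s)/Z_δ(a→b) → |Φ'(s)/Φ'(b)|^{5/8}` ("target transport"); combine it with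
the EXACT lattice restriction identity `Z_{Λ'}/Z_Λ = P^Λ(γ ⊂ Λ')` and let `s` COALESCE with the source
`a`: the telescoping `r_ab = r_as · T(s)/T'(s)` turns the within-domain ratios into the cross-domain
avoidance cocycle `P^C_δ(γ avoids C ∖ D') → Φ'_A(0)^{5/8}` — the SLE_{8/3} value ([LSW03] Thm. 6.1) — as
soon as short wall-to-wall arcs are local (`r_as → 1` as `s → a` uniformly in `δ`): the open input
(SL′) = `stub_arcLocality`, stated here in the reduced half-plane lattice form (T_ℍ) asked for by triage
r1-2/r1-3. Identification is then [LSW03] `P_{5/8}`-uniqueness, PROVED in the tree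
(`IsRestrictionMeasure.unique`, `ext_of_avoid_holds`, `sle_restriction_eightThirds_holds`), plus the
lattice no-retrace input (`stub_noRetrace`) to pass from the range to the curve; the class extension
(refuter warning W2) is `stub_extension`. No slit domain, no Loewner chain, no phase (W1, W3 moot).

The composition `ObservableToSLE_of` is sorry-free over the seven stubs and concludes the route decl BY
NAME through the landed negative-side theorem
`Theorems.ObservableToSLE.Negative.observableToSLE_iff_identification` (cdisprove gen 2, p69742).

Conventions fixed here (see the card `Lines/coalescent-arc-restriction.md`):
* the base class of the line is `FlatOnLine C ρ ∧ Convex ℝ C.carrier`: `C ⊆ ℍ` with both marked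
  points ON the real axis and `C` equal to the upper half-disc near each of them — for such `C` the
  canonical discretisation `C_δ` (`embMeshDomain`) has zigzag bottom rows `x₁ ≥ 0` near `a`, `b` for
  EVERY `δ` (the boundary mid-edges below row `0` sit on `ℝ`), so `HexObservableLimit` applies to it
  verbatim (`m_δ = 0`), and convexity makes mesh edges = lattice edges;
* endpoints of the base class are bottom-row up-vertices (`BottomRow`), whose dangling mid-edges
  `src` are boundary mid-edges of `C_δ`;
* every other Dobrushin domain / endpoint approximation is reached through `stub_extension` (W2).
-/

noncomputable section

open MeasureTheory Filter Topology Set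
open scoped NNReal ENNReal
open UpperHalfPlane (upperHalfPlaneSet)
open Literature.Probability.LatticeModels
open Literature.Probability.RandomPlanarGeometry
open Literature.Probability.RandomPlanarGeometry.SAW
open Summit.CriticalPhenomena.SAWScalingLimit.Theses.SAWDevelopingMap
open Summit.CriticalPhenomena.SAWScalingLimit.Theorems.ObservableToSLE.Negative

namespace Summit.CriticalPhenomena.SAWScalingLimit.Cruxes.ObservableToSLE.CoalescentArcRestriction

/-! ## Vocabulary of the line (local abbreviations; statements only) -/

/-- `Z_Λ(a, z) = Σ_{γ ⊂ Λ : a → z} x_c^{ℓ(γ)}`: the critical mid-edge SAW partition function of the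
lattice domain `Λ` (world of `HexObservableLimit`; `= ‖F(z)‖` when `a, z ∈ ∂Λ`, `Λ` simply connected,
by the deterministic boundary winding). -/
def Zxc (Λ : Finset HexVertex) (a z : Sym2 HexVertex) : ℝ :=
  ∑ γ : HexMidEdgeSAW Λ a z, hexCriticalFugacity ^ γ.length

/-- The dangling (vertical) boundary mid-edge BELOW the bottom-row up-vertex of column `j`:
`{(⟨j,0⟩, up), (⟨j,-1⟩, down)}`; its midpoint is `j + 1/2 ∈ ℝ` (height `0`). -/
def src (j : ℤ) : Sym2 HexVertex :=
  s((((![j, 0] : Site 2)), (0 : Fin 2)), (((![j, -1] : Site 2)), (1 : Fin 2)))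

/-- The lattice HALF-BOX of radius `R` around column `j`: cells `x₀ ∈ [j - R, j + R]`, rows
`x₁ ∈ [0, R]` (both sublattices) — a parallelogram of zigzag rows sitting on the bottom row `x₁ = 0`
whose dangling mid-edges `src` lie on the real axis. -/
def halfBox (j : ℤ) (R : ℕ) : Finset HexVertex :=
  ((Finset.Icc (j - (R : ℤ)) (j + (R : ℤ)) ×ˢ Finset.Icc (0 : ℤ) (R : ℤ)) ×ˢ
      (Finset.univ : Finset (Fin 2))).image
    fun p => (((![p.1.1, p.1.2] : Site 2)), p.2)

/-- **The base class of the line.** `C` lies in the upper half-plane, both marked points are on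
the real axis and `C` coincides with the open upper half-disc of radius `ρ` around each of them
(so the canonical discretisation has flat zigzag rows `x₁ ≥ 0` there for every mesh `δ`, and the
monotone reduction of arc locality stays inside `ℍ`, triage r1-3). -/
def FlatOnLine (C : DobrushinDomain) (ρ : ℝ) : Prop :=
  0 < ρ ∧ C.carrier ⊆ upperHalfPlaneSet ∧
    ∀ i : Fin 2, (C.pt i).im = 0 ∧
      C.carrier ∩ Metric.ball (C.pt i) ρ = upperHalfPlaneSet ∩ Metric.ball (C.pt i) ρ

/-- Endpoint approximations by BOTTOM-ROW up-vertices (row `x₁ = 0`, sublattice `0`): their dangling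
mid-edges `src` are boundary mid-edges of the discretisation, as `HexObservableLimit` wants. -/
def BottomRow (a b : ℝ → HexVertex) : Prop :=
  ∀ᶠ δ : ℝ in 𝓝[>] 0, (a δ).2 = 0 ∧ (a δ).1 1 = 0 ∧ (b δ).2 = 0 ∧ (b δ).1 1 = 0

/-- Boundary data of a domain `D` in the format of `HexObservableLimit`: a conformal map
`Ψ : D → ℍ` with `Ψ(pt 0) = ∞`, `Ψ(pt 1) = 0`, a continuous logarithm `L` of `Ψ'` on `D`, its limit
`Lb` at `pt 1` and its limits `Ls s` at the real boundary points `s ≠ re (pt 0)` within `ρ'` of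
`pt 0` (the flat piece through the source). -/
def BoundaryData (D : DobrushinDomain) (Ψ : ConformalEquiv D.carrier upperHalfPlaneSet)
    (L : ℂ → ℂ) (Lb : ℂ) (Ls : ℝ → ℂ) (ρ' : ℝ) : Prop :=
  Tendsto (fun x => ‖Ψ x‖) (𝓝[D.carrier] (D.pt 0)) atTop ∧ Ψ.HasBoundaryValue (D.pt 1) 0 ∧
    ContinuousOn L D.carrier ∧ (∀ z ∈ D.carrier, Complex.exp (L z) = deriv Ψ z) ∧
    Tendsto L (𝓝[D.carrier] (D.pt 1)) (𝓝 Lb) ∧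
    ∀ s : ℝ, s ≠ (D.pt 0).re → |s - (D.pt 0).re| < ρ' →
      Tendsto L (𝓝[D.carrier] (s : ℂ)) (𝓝 (Ls s))

/-! ## The seven statements -/

/-- **Target transport** (the two-normalisation ratio; FREE from `HexObservableLimit`), in the
form the cocycle consumes. For a Dobrushin domain `D ⊆ ℍ` whose normalisation point `pt 1` and a
second boundary point `s ≠ pt 0` lie ON the real axis with `D` the upper half-disc near each, an
admissible discretisation family `Λ_δ` (exactly the clauses of `HexObservableLimit`; near the two
points the rows are `x₁ ≥ 0`, i.e. `m_δ = 0`) and wall mid-edges `src (ja δ) → pt 0`,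
`src (jb δ) → pt 1`, `src (je δ) → s` on the bottom row:
`Z_δ(a→e)/Z_δ(a→b) → exp((5/8) Re(L_s − L_b)) = |Φ'(s)/Φ'(b)|^{5/8}`.
Proof route: two instances of `HexObservableLimit` — `(D; pt 0, pt 1)` and the re-marked
`(D; pt 0, s)` with `Φ − Φ(s)` (`Φ(s) ∈ ℝ` exists because `L → L_s`; same `Λ_δ`, same `F_δ`, same
`L`, same universal `c`), one bump `ψ` with `∫ψe^{(5/8)L} ≠ 0`, divide, take norms; finally
`‖F_δ(src j)‖ = Z_δ(a → src j)`: every walk of `Λ_δ ⊆ {x₁ ≥ 0}` from the wall mid-edge `src (ja δ)`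
(lowest point, first step vertical) out through the wall mid-edge `src j` has the same winding `∓π`
(Hopf's formula of the tree, `HV.pturn_walk_eq`, as in DCS's "the winding to the bottom part `α`
is `±π`"). -/
def TargetTransport : Prop :=
  ∀ (D : DobrushinDomain) (s : ℝ) (ρ : ℝ) (Λ : ℝ → Finset HexVertex) (ja jb je : ℝ → ℤ)
    (Φ : ConformalEquiv D.carrier upperHalfPlaneSet) (L : ℂ → ℂ) (Lb Ls : ℂ),
    0 < ρ → D.carrier ⊆ upperHalfPlaneSet → (D.pt 1).im = 0 →
    (s : ℂ) ∈ frontier D.carrier → (s : ℂ) ≠ D.pt 0 →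
    D.carrier ∩ Metric.ball (D.pt 1) ρ = upperHalfPlaneSet ∩ Metric.ball (D.pt 1) ρ →
    D.carrier ∩ Metric.ball (s : ℂ) ρ = upperHalfPlaneSet ∩ Metric.ball (s : ℂ) ρ →
    (∀ᶠ δ : ℝ in 𝓝[>] 0,
      hexDomainSimplyConnected (Λ δ) ∧ src (ja δ) ∈ hexDomainBoundary (Λ δ) ∧
        src (jb δ) ∈ hexDomainBoundary (Λ δ) ∧ src (je δ) ∈ hexDomainBoundary (Λ δ) ∧
        Nonempty (HexMidEdgeSAW (Λ δ) (src (ja δ)) (src (jb δ))) ∧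
        Nonempty (HexMidEdgeSAW (Λ δ) (src (ja δ)) (src (je δ))) ∧
        (hexGraph.induce ((Λ δ : Finset HexVertex) : Set HexVertex)).Preconnected ∧
        (∀ v ∈ Λ δ, (δ : ℂ) * hexCenter v ∈ D.carrier) ∧
        (∀ v : HexVertex, (δ : ℂ) * hexCenter v ∈ Metric.ball (D.pt 1) ρ ∪ Metric.ball (s : ℂ) ρ →
          (v ∈ Λ δ ↔ 0 ≤ v.1 1))) →
    (∀ K : Set ℂ, IsCompact K → K ⊆ D.carrier →
      ∀ᶠ δ : ℝ in 𝓝[>] 0, ∀ v : HexVertex, (δ : ℂ) * hexCenter v ∈ K → v ∈ Λ δ) →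
    Tendsto (fun δ : ℝ => (δ : ℂ) * hexMidpoint (src (ja δ))) (𝓝[>] 0) (𝓝 (D.pt 0)) →
    Tendsto (fun δ : ℝ => (δ : ℂ) * hexMidpoint (src (jb δ))) (𝓝[>] 0) (𝓝 (D.pt 1)) →
    Tendsto (fun δ : ℝ => (δ : ℂ) * hexMidpoint (src (je δ))) (𝓝[>] 0) (𝓝 (s : ℂ)) →
    Tendsto (fun x => ‖Φ x‖) (𝓝[D.carrier] (D.pt 0)) atTop → Φ.HasBoundaryValue (D.pt 1) 0 →
    ContinuousOn L D.carrier → (∀ z ∈ D.carrier, Complex.exp (L z) = deriv Φ z) →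
    Tendsto L (𝓝[D.carrier] (D.pt 1)) (𝓝 Lb) → Tendsto L (𝓝[D.carrier] (s : ℂ)) (𝓝 Ls) →
    Tendsto (fun δ : ℝ =>
        Zxc (Λ δ) (src (ja δ)) (src (je δ)) / Zxc (Λ δ) (src (ja δ)) (src (jb δ))) (𝓝[>] 0)
      (𝓝 (Real.exp ((5 / 8 : ℝ) * (Ls - Lb).re)))

/-- **(SL′) Arc locality, reduced lattice form (T_ℍ)** — the load-bearing open input. For every
`ε > 0` there is a scale ratio `K` such that, for the critical (`x_c`-weighted) walks of the lattice
half-box of radius `R` from the wall mid-edge of column `j` to the wall mid-edge of column `j + m`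
(`m ≠ 0`), the sub-box of radius `M ≥ K|m|` already carries all but an `ε`-fraction of the mass,
uniformly in `R ≥ M`: `(1 − ε) Z_{halfBox j R} ≤ Z_{halfBox j M}`. (Letting `R → ∞`: point-to-point
wall arcs of the half-plane are local at LINEAR scale separation; conjectured deficit `≍ (m/M)²`, the
SLE_{8/3} boundary two-leg exponent. Absolute convergence for each fixed `m` is DCS Lemma 2; the
content is the uniformity in `m` — a boundary two-arm / arch-tightness statement of RSW species for
the `n = 0` loop model.) -/
def ArcLocality : Prop :=
  ∀ ε : ℝ, 0 < ε → ∃ K : ℕ, ∀ (j m : ℤ) (M R : ℕ), m ≠ 0 → K * m.natAbs ≤ M → M ≤ R →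
    (1 - ε) * Zxc (halfBox j R) (src j) (src (j + m)) ≤ Zxc (halfBox j M) (src j) (src (j + m))

/-- **Coalescence algebra** (conformal bookkeeping, no lattice). For `C` of the base class, a hull
subdomain `D'` with pulled-back hull `A = φ.pullbackHull D'` (chordal `φ : (ℍ;0,∞) → (C;a,b)`),
restriction map `Φ_A` and `d = Φ'_A(0) > 0`: the `HexObservableLimit`-format boundary data EXIST for
`C` and for `D'` (`Ψ = −1/φ⁻¹`, `Ψ' = −1/(Φ_A ∘ φ⁻¹)`; continuous logs of the derivatives; boundary
limits at `b` and at the real points `s` near `a` by Schwarz reflection across the flat pieces), and the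
doubly normalised derivative ratio coalesces:
`Re[(L_s − L_b) − (L'_s − L'_b)] → log d` as `s → a` (because `Ψ''/Ψ'`-free computation:
`(Ψ')'/Ψ' (z) = Φ_A'(w) w²/Φ_A(w)²`, `w = φ⁻¹ z`, which tends to `1/d` at `a` and to `1` at `b`
by the hydrodynamic normalisation). [LSW03 §2 (2.4), §3.1 of DGKLP arXiv:1008.4321] -/
def Coalescence : Prop :=
  ∀ (C D' : DobrushinDomain) (ρ : ℝ) (φ : ConformalEquiv upperHalfPlaneSet C.carrier)
    (Φ : ConformalEquiv (upperHalfPlaneSet \ φ.pullbackHull D') upperHalfPlaneSet) (d : ℝ),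
    FlatOnLine C ρ → C.IsHullSubdomain D' → C.IsChordalUniformizing φ →
    IsRestrictionMap (φ.pullbackHull D') Φ → HasRestrictionDeriv (φ.pullbackHull D') Φ d → 0 < d →
    ∃ (Ψ : ConformalEquiv C.carrier upperHalfPlaneSet) (L : ℂ → ℂ) (Lb : ℂ) (Ls : ℝ → ℂ)
      (Ψ' : ConformalEquiv D'.carrier upperHalfPlaneSet) (L' : ℂ → ℂ) (Lb' : ℂ) (Ls' : ℝ → ℂ)
      (ρ' : ℝ),
      0 < ρ' ∧ ρ' ≤ ρ ∧
        (Metric.ball (C.pt 0) ρ' ∪ Metric.ball (C.pt 1) ρ') ∩ C.carrier ⊆ D'.carrier ∧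
        BoundaryData C Ψ L Lb Ls ρ' ∧ BoundaryData D' Ψ' L' Lb' Ls' ρ' ∧
        Tendsto (fun s : ℝ => ((Ls s - Lb) - (Ls' s - Lb')).re) (𝓝[≠] (C.pt 0).re)
          (𝓝 (Real.log d))

/-- **The restriction cocycle of the critical hexagonal SAW** (waypoint of the line; derivable from
the three statements above). For `C` of the base class, CONVEX, with bottom-row endpoint
approximations, and a Jordan hull subdomain `D'` whose cut `C ∖ D'` consists of finitely many
connected pieces each adhering to `∂C`: the probability that the critical SAW of `C_δ` keeps all its
vertices `3δ` away from the cut tends to `Φ'_A(0)^{5/8}`, `A = φ.pullbackHull D'` — the SLE_{8/3}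
value of `P(γ ∩ A = ∅)` ([LSW03] Thm. 6.1). (`3δ`-thickening: an edge has length `δ/√3`, so such a walk
does not cross the cut, and the vertices of `C_δ` within `3δ` of a connected piece adhering to `∂C`
form, with `C_δᶜ`, a lattice-connected set — the complement of the ADMISSIBLE sub-family `Λ'_δ` to
which target transport is applied in `D'`.) Proof route: dictionary `HexDomainSAW C_δ ≃ HexMidEdgeSAW`
(convexity), exact restriction `Z_{Λ'}/Z_Λ = P(support ⊆ Λ')`, telescoping
`r_b = r_s · T(s)/T'(s)` with two target transports, `r_s ≤ 1` and `r_s ≥ 1 − ε(s)` from arc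
locality (`halfBox ⊆ Λ'_δ` near `a`, `Λ_δ ⊆ halfBox j R` since `C ⊆ ℍ`), then `s → a` by coalescence. -/
def RestrictionCocycleLimit : Prop :=
  ∀ (C D' : DobrushinDomain) (ρ : ℝ) (φ : ConformalEquiv upperHalfPlaneSet C.carrier)
    (Φ : ConformalEquiv (upperHalfPlaneSet \ φ.pullbackHull D') upperHalfPlaneSet) (d : ℝ)
    (k : ℕ) (Q : Fin k → Set ℂ) (a b : ℝ → HexVertex),
    FlatOnLine C ρ → Convex ℝ C.carrier → C.IsHullSubdomain D' → C.IsChordalUniformizing φ →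
    IsRestrictionMap (φ.pullbackHull D') Φ → HasRestrictionDeriv (φ.pullbackHull D') Φ d → 0 < d →
    C.carrier \ D'.carrier = ⋃ i, Q i →
    (∀ i, IsConnected (Q i) ∧ (closure (Q i) ∩ frontier C.carrier).Nonempty) →
    IsEmbEndpointApprox hexGraph hexCenter C a b → BottomRow a b →
    Tendsto (fun δ : ℝ =>
        (hexSAWLaw C.carrier δ (a δ) (b δ)
          {γ | ∀ v ∈ γ.walk.support, ∀ z ∈ C.carrier \ D'.carrier,
              3 * δ < dist ((δ : ℂ) * hexCenter v) z}).toReal)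
      (𝓝[>] 0) (𝓝 (d ^ ((5 : ℝ) / 8)))

/-- **No retrace** (lattice, uniform in the mesh) — the range → curve input. For every Dobrushin
domain and endpoint approximation, every `ε, η > 0`: there is `r > 0` such that, for all small
meshes, with probability `≤ η` the critical SAW never RETURNS within distance `r` of an earlier vertex
after having travelled `ε` away from it (no back-and-forth traversal of its own — conjecturally
simple — range; near-closing of an `ε`-loop at scale `r ≫ δ`). Implied by Conjecture 1 (SLE_{8/3} is
simple and the event is closed as `r ↓`); strictly weaker than KS Condition G2; shares its flavour
with `SAWConfRestriction.SimpleOfLimit`. -/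
def NoRetrace : Prop :=
  ∀ (D : DobrushinDomain) (a b : ℝ → HexVertex), IsEmbEndpointApprox hexGraph hexCenter D a b →
    ∀ ε η : ℝ, 0 < ε → 0 < η → ∃ r : ℝ, 0 < r ∧ ∀ᶠ δ : ℝ in 𝓝[>] 0,
      hexSAWLaw D.carrier δ (a δ) (b δ)
          {γ | ∃ i j k : ℕ, i ≤ j ∧ j ≤ k ∧ k ≤ γ.walk.length ∧
              dist ((δ : ℂ) * hexCenter (γ.walk.getVert i)) ((δ : ℂ) * hexCenter (γ.walk.getVert k)) ≤ r ∧
              ε ≤ dist ((δ : ℂ) * hexCenter (γ.walk.getVert i)) ((δ : ℂ) * hexCenter (γ.walk.getVert j))}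
        ≤ ENNReal.ofReal η

/-- **Identification in the base class** (derivable from the cocycle and no-retrace by [LSW03]
`P_{5/8}`-uniqueness, all in the tree). For `C` of the base class, convex, bottom-row endpoint
approximations, and a tight family of critical SAW laws: every subsequential limit law is the chordal
SLE_{8/3} law of `(C; a, b)`. Route: portmanteau on the open avoidance events + monotone squeeze by
fat cuts + kernel continuity (`HasRestrictionDeriv.tendsto_of_kernel_holds`) give
`μ(range ∩ φ(A) = ∅) = Φ'_A(0)^{5/8}` for all `*`-hulls (thin hulls: `μ` misses `∂C ∖ {a,b}`); pull back
(`pullbackConfig`), `IsRestrictionMeasure (5/8)`, `IsRestrictionMeasure.unique` with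
`sle_restriction_eightThirds_holds`; range → curve by `NoRetrace` (a double point of a curve on a
simple arc forces an `ε`-excursion closing at scale `0`) and `CurveClass.Measure.ext_of_missCode_injOn`;
hence `μ =` the SLE_{8/3} law (`exists_isSLELaw_of_ne_eight`). -/
def FlatIdentification : Prop :=
  ∀ (C : DobrushinDomain) (ρ : ℝ) (a b : ℝ → HexVertex),
    FlatOnLine C ρ → Convex ℝ C.carrier →
    IsEmbEndpointApprox hexGraph hexCenter C a b → BottomRow a b →
    IsTightAlongMesh (fun δ (γ : HexDomainSAW C.carrier δ (a δ) (b δ)) => γ.curve)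
      (fun δ => hexSAWLaw C.carrier δ (a δ) (b δ)) →
    ∀ μ : Measure (CurveClass ℂ), IsProbabilityMeasure μ →
      IsSubseqLimitLaw (fun δ (γ : HexDomainSAW C.carrier δ (a δ) (b δ)) => γ.curve)
        (fun δ => hexSAWLaw C.carrier δ (a δ) (b δ)) μ →
      IsSLELaw ((8 : ℝ≥0) / 3) C μ

/-- **Identification** — the right-hand side of the landed equivalence
`observableToSLE_iff_identification` (minus its two crux hypotheses): every subsequential limit law
of the critical hexagonal SAW in every Dobrushin domain with every endpoint approximation is the
chordal SLE_{8/3} law. -/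
def Identification : Prop :=
  ∀ (D : DobrushinDomain) (a b : ℝ → HexVertex), IsEmbEndpointApprox hexGraph hexCenter D a b →
    ∀ μ : Measure (CurveClass ℂ), IsProbabilityMeasure μ →
      IsSubseqLimitLaw (fun δ (γ : HexDomainSAW D.carrier δ (a δ) (b δ)) => γ.curve)
        (fun δ => hexSAWLaw D.carrier δ (a δ) (b δ)) μ →
      IsSLELaw ((8 : ℝ≥0) / 3) D μ

/-! ## Stubs (registered; `sorry` only here) -/

/-- STUB 1 — target transport is a consequence of the crux hypothesis (two instances of DCS
Conjecture 2 with the normalisation point re-marked, divided; deterministic boundary winding).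
Size M/L. Uses `HexObservableLimit` and nothing else of the crux. -/
theorem stub_targetTransport : HexObservableLimit → TargetTransport := by
  sorry

/-- STUB 2 (HARDEST, open) — (SL′)/(T_ℍ): linear-scale locality of critical wall-to-wall arcs of
the half-plane honeycomb SAW. -/
theorem stub_arcLocality : ArcLocality := by
  sorry

/-- STUB 3 — coalescence algebra: existence of the `HexObservableLimit`-format boundary data for
`C` and its hull subdomains, and `q(s) → 1/Φ'_A(0)` at the source. Size L (Schwarz reflection and
continuous logarithms are not in Mathlib; the tree has `KernelConvergence.reflectExt`,
Carathéodory `_holds` facts, `IsStarHull.exists_hasRestrictionDeriv_holds`). -/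
theorem stub_coalescence : Coalescence := by
  sorry

/-- STUB 4 — the cocycle: target transport + arc locality + coalescence give the restriction
cocycle of the critical SAW on the convex base class (dictionary vertex-SAW/mid-edge-SAW, exact
lattice restriction, admissibility of the canonical and of the cut discretisations, telescoping,
squeeze in `s`). Size L. -/
theorem stub_cocycle : TargetTransport → ArcLocality → Coalescence → RestrictionCocycleLimit := by
  sorry

/-- STUB 5 (open) — lattice no-retrace, uniformly in the mesh. -/
theorem stub_noRetrace : NoRetrace := by
  sorry

/-- STUB 6 — identification on the base class from the cocycle and no-retrace ([LSW03]
uniqueness; every ingredient is a theorem of the tree). Size XL (measure-theoretic bookkeeping). -/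
theorem stub_flatIdentification : RestrictionCocycleLimit → NoRetrace → FlatIdentification := by
  sorry

/-- STUB 7 (open; refuter warning W2, shared by every line through `HexObservableLimit`) — class
extension: from the convex flat-on-`ℝ` class with bottom-row endpoints to ALL Dobrushin domains and
ALL hexagonal endpoint approximations. Handles available to a proof: exact lattice restriction from
the convex hull `conv D ⊇ D` (a FlatOnLine domain `D ⊆ ℍ` is a hull subdomain of its convex hull) +
`IsSLELaw.hullRestriction_eightThirds_holds`; NOTCHED admissible families for interior endpoints
(`HexObservableLimit` constrains `Λ_δ` only near the normalisation point); general rough prime ends at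
`a`, `b` are the genuinely open part. The earlier stubs are theorems of this file and may be used. -/
theorem stub_extension : HexObservableLimit → HexTight → FlatIdentification → Identification := by
  sorry

/-! ## Composition (sorry-free): the seven stubs prove the crux BY NAME -/

/-- **`ObservableToSLE` from the stubs.** By the landed equivalence
`observableToSLE_iff_identification` the crux is exactly identification of subsequential limits
(the soft half — Prokhorov along the mesh, Dirac padding, `convergesInLawToSLE_of_isTightAlongMesh`,
`IsSLECurve.map_eq_holds` — is proved there); identification is `stub_extension` fed with the
base-class identification, itself fed with the cocycle (target transport ∘ arc locality ∘
coalescence) and no-retrace. -/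
theorem ObservableToSLE_of : ObservableToSLE :=
  observableToSLE_iff_identification.mpr fun hO hT D a b hab μ hμ hsub =>
    stub_extension hO hT
      (stub_flatIdentification
        (stub_cocycle (stub_targetTransport hO) stub_arcLocality stub_coalescence)
        stub_noRetrace)
      D a b hab μ hμ hsub

end Summit.CriticalPhenomena.SAWScalingLimit.Cruxes.ObservableToSLE.CoalescentArcRestriction

end
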